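import Mathlib.LinearAlgebra.Matrix.Determinant.Basic
import Mathlib.LinearAlgebra.Matrix.RowCol
import Mathlib.Data.Complex.Basic
import Mathlib.Tactic.FinCases
import Mathlib.Tactic.Ring
import Mathlib.Tactic.Tauto

/-!
# `FiveTermTransfer` (stmt-KontsevichZagierPeriods-3469) — line `valuation-kernel-sweep`,
stub `stub_detDictionary`

The determinant dictionary of the paraboloid lift.  Lifting a point `p` of the upper half space
to `Q = (|p|², p₀, p₁, 1) ∈ ℝ⁴` and the ideal points of the configuration `{∞, 0, 1, x, y}` to
`ℓ'(∞) = (1, 0, 0, 0)`, `ℓ'(w) = (|w|², Re w, Im w, 1)` makes every geodesic face linear: the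
route's forms are determinants, `S u v w p = det[Q; ℓ'u; ℓ'v; ℓ'w]` and
`L u v p = det[ℓ'∞; Q; ℓ'u; ℓ'v]`.  With `v = (ℓ'∞, ℓ'0, ℓ'1, ℓ'x, ℓ'y)`, `D j` the `4 × 4` minor
omitting row `j` and `E j a` the same minor with its `a`-th row replaced by `Q`, we evaluate the
five minors `D j` in closed form and show that each of the five solids of the five-term relation
is exactly the set `{p | 0 < p₂ ∧ ∀ a, 0 < D j * E j a}` ("all four Cramer coordinates have the
sign of `D j`").  Everything is a polynomial identity (Laplace expansion + `ring`); no hypothesis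
on `x`, `y`, `p` is needed. [folklore]
-/

noncomputable section

namespace Summit.KontsevichZagierPeriods.HyperbolicBloch.FiveTerm

/-- Laplace expansion of a `4 × 4` determinant along the first row. [folklore] -/
private theorem det_four {R : Type*} [CommRing R] (A : Matrix (Fin 4) (Fin 4) R) :
    A.det =
      A 0 0 * (A 1 1 * A 2 2 * A 3 3 - A 1 1 * A 2 3 * A 3 2 - A 1 2 * A 2 1 * A 3 3
        + A 1 2 * A 2 3 * A 3 1 + A 1 3 * A 2 1 * A 3 2 - A 1 3 * A 2 2 * A 3 1)
      - A 0 1 * (A 1 0 * A 2 2 * A 3 3 - A 1 0 * A 2 3 * A 3 2 - A 1 2 * A 2 0 * A 3 3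
        + A 1 2 * A 2 3 * A 3 0 + A 1 3 * A 2 0 * A 3 2 - A 1 3 * A 2 2 * A 3 0)
      + A 0 2 * (A 1 0 * A 2 1 * A 3 3 - A 1 0 * A 2 3 * A 3 1 - A 1 1 * A 2 0 * A 3 3
        + A 1 1 * A 2 3 * A 3 0 + A 1 3 * A 2 0 * A 3 1 - A 1 3 * A 2 1 * A 3 0)
      - A 0 3 * (A 1 0 * A 2 1 * A 3 2 - A 1 0 * A 2 2 * A 3 1 - A 1 1 * A 2 0 * A 3 2
        + A 1 1 * A 2 2 * A 3 0 + A 1 2 * A 2 0 * A 3 1 - A 1 2 * A 2 1 * A 3 0) := by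
  -- adapted from Literature/Geometry/Riemannian/TwistorFrameChange.lean (`Matrix.det_fin_four`)
  have s1 : Fin.succ (0 : Fin 3) = (1 : Fin 4) := by decide
  have s2 : Fin.succ (1 : Fin 3) = (2 : Fin 4) := by decide
  have s3 : Fin.succ (2 : Fin 3) = (3 : Fin 4) := by decide
  have a00 : (0 : Fin 4).succAbove (0 : Fin 3) = 1 := by decide
  have a01 : (0 : Fin 4).succAbove (1 : Fin 3) = 2 := by decide
  have a02 : (0 : Fin 4).succAbove (2 : Fin 3) = 3 := by decide
  have a10 : (1 : Fin 4).succAbove (0 : Fin 3) = 0 := by decide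
  have a11 : (1 : Fin 4).succAbove (1 : Fin 3) = 2 := by decide
  have a12 : (1 : Fin 4).succAbove (2 : Fin 3) = 3 := by decide
  have a20 : (2 : Fin 4).succAbove (0 : Fin 3) = 0 := by decide
  have a21 : (2 : Fin 4).succAbove (1 : Fin 3) = 1 := by decide
  have a22 : (2 : Fin 4).succAbove (2 : Fin 3) = 3 := by decide
  have a30 : (3 : Fin 4).succAbove (0 : Fin 3) = 0 := by decide
  have a31 : (3 : Fin 4).succAbove (1 : Fin 3) = 1 := by decide
  have a32 : (3 : Fin 4).succAbove (2 : Fin 3) = 2 := by decide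
  have v3 : ((3 : Fin 4) : ℕ) = 3 := rfl
  rw [Matrix.det_succ_row_zero, Fin.sum_univ_four]
  simp only [Matrix.det_fin_three, Matrix.submatrix_apply, s1, s2, s3, a00, a01, a02, a10, a11,
    a12, a20, a21, a22, a30, a31, a32, Fin.val_zero, Fin.val_one, Fin.val_two, v3, pow_zero,
    pow_one]
  ring

/-- The table of values of `Fin.succAbove : Fin 5 → Fin 4 → Fin 5`. [folklore] -/
private theorem succAbove_five (j : Fin 5) (a : Fin 4) :
    j.succAbove a =
      (![![1, 2, 3, 4], ![0, 2, 3, 4], ![0, 1, 3, 4], ![0, 1, 2, 4], ![0, 1, 2, 3]] :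
        Fin 5 → Fin 4 → Fin 5) j a := by
  revert j a
  decide

/-- A predicate holds on all of `Fin 4` iff it holds at `0, 1, 2, 3`. [folklore] -/
private theorem forall_fin_four {q : Fin 4 → Prop} : (∀ a, q a) ↔ q 0 ∧ q 1 ∧ q 2 ∧ q 3 :=
  ⟨fun h => ⟨h 0, h 1, h 2, h 3⟩, fun h a => by
    fin_cases a
    exacts [h.1, h.2.1, h.2.2.1, h.2.2.2]⟩

/-- **Determinant dictionary of the paraboloid lift.** For the lifted configuration
`v = (ℓ'∞, ℓ'0, ℓ'1, ℓ'x, ℓ'y)` and `Q = (|p|², p₀, p₁, 1)`: the five minors `D j` (row `j`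
omitted) are `Im x`, `Im y`, `Im (x̄ y)`, `Im ((x̄ - 1)(y - 1))`, `-(Im (x̄ y) - |x|² Im y + |y|² Im x)`,
and each of the five solids of the five-term configuration (the four solids `P u v w` with an
ideal vertex at `∞` and the finite ideal tetrahedron `(0, 1, x, y)`) is the set of `p` with
`0 < p₂` and `0 < D j * E j a` for all four Cramer numerators `E j a` (row `a` of the minor
replaced by `Q`).  Pure polynomial identities: Laplace expansion and `ring`. [folklore] -/
theorem stub_detDictionary :
    ∀ (L : ℂ → ℂ → (Fin 3 → ℝ) → ℝ),
      (∀ u v p, L u v p = (v.re - u.re) * (p 1 - u.im) - (v.im - u.im) * (p 0 - u.re)) →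
    ∀ (S : ℂ → ℂ → ℂ → (Fin 3 → ℝ) → ℝ),
      (∀ u v w p, S u v w p = (p 0 ^ 2 + p 1 ^ 2 + p 2 ^ 2) * (u.re * (v.im - w.im) - u.im * (v.re - w.re) + (v.re * w.im - v.im * w.re)) - p 0 * (Complex.normSq u * (v.im - w.im) - u.im * (Complex.normSq v - Complex.normSq w) + (Complex.normSq v * w.im - v.im * Complex.normSq w)) + p 1 * (Complex.normSq u * (v.re - w.re) - u.re * (Complex.normSq v - Complex.normSq w) + (Complex.normSq v * w.re - v.re * Complex.normSq w)) - (Complex.normSq u * (v.re * w.im - v.im * w.re) - u.re * (Complex.normSq v * w.im - v.im * Complex.normSq w) + u.im * (Complex.normSq v * w.re - v.re * Complex.normSq w))) →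
    ∀ (P : ℂ → ℂ → ℂ → Set (Fin 3 → ℝ)),
      (∀ u v w, P u v w = {p | 0 < p 2 ∧ 0 < L u v ![w.re, w.im, 0] * L u v p ∧ 0 < L u v ![w.re, w.im, 0] * L v w p ∧ 0 < L u v ![w.re, w.im, 0] * L w u p ∧ 0 < L u v ![w.re, w.im, 0] * S u v w p}) →
    ∀ (x y : ℂ) (p : Fin 3 → ℝ) (v : Fin 5 → Fin 4 → ℝ),
      v = ![![1, 0, 0, 0], ![0, 0, 0, 1], ![1, 1, 0, 1], ![Complex.normSq x, x.re, x.im, 1], ![Complex.normSq y, y.re, y.im, 1]] →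
    ∀ (Q : Fin 4 → ℝ), Q = ![p 0 ^ 2 + p 1 ^ 2 + p 2 ^ 2, p 0, p 1, 1] →
    ∀ (D : Fin 5 → ℝ), (∀ j, D j = (Matrix.of fun a b => v (j.succAbove a) b).det) →
    ∀ (E : Fin 5 → Fin 4 → ℝ), (∀ j a, E j a = ((Matrix.of fun a' b => v (j.succAbove a') b).updateRow a Q).det) →
      (D 4 = x.im ∧ D 3 = y.im ∧ D 2 = x.re * y.im - x.im * y.re ∧
        D 1 = (x.re - 1) * y.im - x.im * (y.re - 1) ∧
        D 0 = -(x.re * y.im - x.im * y.re - Complex.normSq x * y.im + x.im * Complex.normSq y)) ∧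
      (p ∈ P 0 1 x ↔ 0 < p 2 ∧ ∀ a, 0 < D 4 * E 4 a) ∧
      (p ∈ P 0 1 y ↔ 0 < p 2 ∧ ∀ a, 0 < D 3 * E 3 a) ∧
      (p ∈ P 0 x y ↔ 0 < p 2 ∧ ∀ a, 0 < D 2 * E 2 a) ∧
      (p ∈ P 1 y x ↔ 0 < p 2 ∧ ∀ a, 0 < D 1 * E 1 a) ∧
      (p ∈ {q : Fin 3 → ℝ | 0 < q 2 ∧ 0 < S 1 x y q * S 1 x y ![0, 0, 0] ∧ 0 < S 0 x y q * S 0 x y ![1, 0, 0] ∧ 0 < S 0 1 y q * S 0 1 y ![x.re, x.im, 0] ∧ 0 < S 0 1 x q * S 0 1 x ![y.re, y.im, 0]} ↔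
        0 < p 2 ∧ ∀ a, 0 < D 0 * E 0 a) := by
  intro L hL S hS P hP x y p v hv Q hQ D hD E hE
  subst hv hQ
  -- the five minors
  have d4 : D 4 = x.im := by
    simp only [hD, det_four, Matrix.of_apply, succAbove_five, Matrix.cons_val]
    ring
  have d3 : D 3 = y.im := by
    simp only [hD, det_four, Matrix.of_apply, succAbove_five, Matrix.cons_val]
    ring
  have d2 : D 2 = x.re * y.im - x.im * y.re := by
    simp only [hD, det_four, Matrix.of_apply, succAbove_five, Matrix.cons_val]
    ring
  have d1 : D 1 = (x.re - 1) * y.im - x.im * (y.re - 1) := by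
    simp only [hD, det_four, Matrix.of_apply, succAbove_five, Matrix.cons_val]
    ring
  have d0 : D 0 = -(x.re * y.im - x.im * y.re - Complex.normSq x * y.im
      + x.im * Complex.normSq y) := by
    simp only [hD, det_four, Matrix.of_apply, succAbove_five, Matrix.cons_val]
    ring
  -- the twenty products `D j * E j a`, as the products occurring in the solids
  have m40 : D 4 * E 4 0 = L 0 1 ![x.re, x.im, 0] * S 0 1 x p := by
    simp only [d4, hE, hL, hS, det_four, Matrix.of_apply, Matrix.updateRow_apply, succAbove_five,
      Matrix.cons_val, Fin.isValue, Fin.reduceEq, if_true, if_false, Complex.zero_re,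
      Complex.zero_im, Complex.one_re, Complex.one_im, Complex.normSq_zero, Complex.normSq_one]
    ring
  have m41 : D 4 * E 4 1 = L 0 1 ![x.re, x.im, 0] * L 1 x p := by
    simp only [d4, hE, hL, det_four, Matrix.of_apply, Matrix.updateRow_apply, succAbove_five,
      Matrix.cons_val, Fin.isValue, Fin.reduceEq, if_true, if_false, Complex.zero_re,
      Complex.zero_im, Complex.one_re, Complex.one_im]
    ring
  have m42 : D 4 * E 4 2 = L 0 1 ![x.re, x.im, 0] * L x 0 p := by
    simp only [d4, hE, hL, det_four, Matrix.of_apply, Matrix.updateRow_apply, succAbove_five,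
      Matrix.cons_val, Fin.isValue, Fin.reduceEq, if_true, if_false, Complex.zero_re,
      Complex.zero_im, Complex.one_re, Complex.one_im]
    ring
  have m43 : D 4 * E 4 3 = L 0 1 ![x.re, x.im, 0] * L 0 1 p := by
    simp only [d4, hE, hL, det_four, Matrix.of_apply, Matrix.updateRow_apply, succAbove_five,
      Matrix.cons_val, Fin.isValue, Fin.reduceEq, if_true, if_false, Complex.zero_re,
      Complex.zero_im, Complex.one_re, Complex.one_im]
    ring
  have m30 : D 3 * E 3 0 = L 0 1 ![y.re, y.im, 0] * S 0 1 y p := by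
    simp only [d3, hE, hL, hS, det_four, Matrix.of_apply, Matrix.updateRow_apply, succAbove_five,
      Matrix.cons_val, Fin.isValue, Fin.reduceEq, if_true, if_false, Complex.zero_re,
      Complex.zero_im, Complex.one_re, Complex.one_im, Complex.normSq_zero, Complex.normSq_one]
    ring
  have m31 : D 3 * E 3 1 = L 0 1 ![y.re, y.im, 0] * L 1 y p := by
    simp only [d3, hE, hL, det_four, Matrix.of_apply, Matrix.updateRow_apply, succAbove_five,
      Matrix.cons_val, Fin.isValue, Fin.reduceEq, if_true, if_false, Complex.zero_re,
      Complex.zero_im, Complex.one_re, Complex.one_im]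
    ring
  have m32 : D 3 * E 3 2 = L 0 1 ![y.re, y.im, 0] * L y 0 p := by
    simp only [d3, hE, hL, det_four, Matrix.of_apply, Matrix.updateRow_apply, succAbove_five,
      Matrix.cons_val, Fin.isValue, Fin.reduceEq, if_true, if_false, Complex.zero_re,
      Complex.zero_im, Complex.one_re, Complex.one_im]
    ring
  have m33 : D 3 * E 3 3 = L 0 1 ![y.re, y.im, 0] * L 0 1 p := by
    simp only [d3, hE, hL, det_four, Matrix.of_apply, Matrix.updateRow_apply, succAbove_five,
      Matrix.cons_val, Fin.isValue, Fin.reduceEq, if_true, if_false, Complex.zero_re,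
      Complex.zero_im, Complex.one_re, Complex.one_im]
    ring
  have m20 : D 2 * E 2 0 = L 0 x ![y.re, y.im, 0] * S 0 x y p := by
    simp only [d2, hE, hL, hS, det_four, Matrix.of_apply, Matrix.updateRow_apply, succAbove_five,
      Matrix.cons_val, Fin.isValue, Fin.reduceEq, if_true, if_false, Complex.zero_re,
      Complex.zero_im, Complex.normSq_zero]
    ring
  have m21 : D 2 * E 2 1 = L 0 x ![y.re, y.im, 0] * L x y p := by
    simp only [d2, hE, hL, det_four, Matrix.of_apply, Matrix.updateRow_apply, succAbove_five,
      Matrix.cons_val, Fin.isValue, Fin.reduceEq, if_true, if_false, Complex.zero_re,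
      Complex.zero_im]
    ring
  have m22 : D 2 * E 2 2 = L 0 x ![y.re, y.im, 0] * L y 0 p := by
    simp only [d2, hE, hL, det_four, Matrix.of_apply, Matrix.updateRow_apply, succAbove_five,
      Matrix.cons_val, Fin.isValue, Fin.reduceEq, if_true, if_false, Complex.zero_re,
      Complex.zero_im]
    ring
  have m23 : D 2 * E 2 3 = L 0 x ![y.re, y.im, 0] * L 0 x p := by
    simp only [d2, hE, hL, det_four, Matrix.of_apply, Matrix.updateRow_apply, succAbove_five,
      Matrix.cons_val, Fin.isValue, Fin.reduceEq, if_true, if_false, Complex.zero_re,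
      Complex.zero_im]
    ring
  have m10 : D 1 * E 1 0 = L 1 y ![x.re, x.im, 0] * S 1 y x p := by
    simp only [d1, hE, hL, hS, det_four, Matrix.of_apply, Matrix.updateRow_apply, succAbove_five,
      Matrix.cons_val, Fin.isValue, Fin.reduceEq, if_true, if_false, Complex.one_re,
      Complex.one_im, Complex.normSq_one]
    ring
  have m11 : D 1 * E 1 1 = L 1 y ![x.re, x.im, 0] * L y x p := by
    simp only [d1, hE, hL, det_four, Matrix.of_apply, Matrix.updateRow_apply, succAbove_five,
      Matrix.cons_val, Fin.isValue, Fin.reduceEq, if_true, if_false, Complex.one_re,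
      Complex.one_im]
    ring
  have m12 : D 1 * E 1 2 = L 1 y ![x.re, x.im, 0] * L 1 y p := by
    simp only [d1, hE, hL, det_four, Matrix.of_apply, Matrix.updateRow_apply, succAbove_five,
      Matrix.cons_val, Fin.isValue, Fin.reduceEq, if_true, if_false, Complex.one_re,
      Complex.one_im]
    ring
  have m13 : D 1 * E 1 3 = L 1 y ![x.re, x.im, 0] * L x 1 p := by
    simp only [d1, hE, hL, det_four, Matrix.of_apply, Matrix.updateRow_apply, succAbove_five,
      Matrix.cons_val, Fin.isValue, Fin.reduceEq, if_true, if_false, Complex.one_re,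
      Complex.one_im]
    ring
  have m00 : D 0 * E 0 0 = S 1 x y p * S 1 x y ![0, 0, 0] := by
    simp only [d0, hE, hS, det_four, Matrix.of_apply, Matrix.updateRow_apply, succAbove_five,
      Matrix.cons_val, Fin.isValue, Fin.reduceEq, if_true, if_false, Complex.one_re,
      Complex.one_im, Complex.normSq_one]
    ring
  have m01 : D 0 * E 0 1 = S 0 x y p * S 0 x y ![1, 0, 0] := by
    simp only [d0, hE, hS, det_four, Matrix.of_apply, Matrix.updateRow_apply, succAbove_five,
      Matrix.cons_val, Fin.isValue, Fin.reduceEq, if_true, if_false, Complex.zero_re,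
      Complex.zero_im, Complex.normSq_zero]
    ring
  have m02 : D 0 * E 0 2 = S 0 1 y p * S 0 1 y ![x.re, x.im, 0] := by
    simp only [d0, hE, hS, det_four, Matrix.of_apply, Matrix.updateRow_apply, succAbove_five,
      Matrix.cons_val, Fin.isValue, Fin.reduceEq, if_true, if_false, Complex.zero_re,
      Complex.zero_im, Complex.one_re, Complex.one_im, Complex.normSq_apply]
    ring
  have m03 : D 0 * E 0 3 = S 0 1 x p * S 0 1 x ![y.re, y.im, 0] := by
    simp only [d0, hE, hS, det_four, Matrix.of_apply, Matrix.updateRow_apply, succAbove_five,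
      Matrix.cons_val, Fin.isValue, Fin.reduceEq, if_true, if_false, Complex.zero_re,
      Complex.zero_im, Complex.one_re, Complex.one_im, Complex.normSq_apply]
    ring
  -- assembly
  refine ⟨⟨d4, d3, d2, d1, d0⟩, ?_, ?_, ?_, ?_, ?_⟩
  · simp only [hP, Set.mem_setOf_eq, forall_fin_four, m40, m41, m42, m43]
    tauto
  · simp only [hP, Set.mem_setOf_eq, forall_fin_four, m30, m31, m32, m33]
    tauto
  · simp only [hP, Set.mem_setOf_eq, forall_fin_four, m20, m21, m22, m23]
    tauto
  · simp only [hP, Set.mem_setOf_eq, forall_fin_four, m10, m11, m12, m13]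
    tauto
  · simp only [Set.mem_setOf_eq, forall_fin_four, m00, m01, m02, m03]

end Summit.KontsevichZagierPeriods.HyperbolicBloch.FiveTerm

end
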